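import Mathlib
import Summits.Ventures.PercRepro2.Defs
import Summits.Ventures.PercRepro2.Independence
import Summits.Ventures.PercRepro2.Harris
import Summits.Ventures.PercRepro2.Graph
import Summits.Ventures.PercRepro2.Exploration
import Summits.Ventures.PercRepro2.Events
import Summits.Ventures.PercRepro2.FourFunctions
import Summits.Ventures.PercRepro2.Induced
import Summits.Ventures.PercRepro2.Frontier
import Summits.Ventures.PercRepro2.ObsIndependence
import Summits.Ventures.PercRepro2.BHK
import Summits.Ventures.PercRepro2.BHKEvents
import Summits.Ventures.PercRepro2.MultiSource
import Summits.Ventures.PercRepro2.OrderPreservation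
import Summits.Ventures.PercRepro2.SeedSet
import Summits.Ventures.PercRepro2.MultiSourceFun
import Summits.Ventures.PercRepro2.CrossRootT
import Summits.Ventures.PercRepro2.VdBKahn
import Summits.Ventures.PercRepro2.HullDefs
import Summits.Ventures.PercRepro2.CCTRootEdge
import Summits.Ventures.PercRepro2.CCTAvoidedEdge
import Summits.Ventures.PercRepro2.R1Rung
import Summits.Ventures.PercRepro2.CC2Rung
import Summits.Ventures.PercRepro2.PASubDefs
import Summits.Ventures.PercRepro2.HalfN
import Summits.Ventures.PercRepro2.CCTLin
import Summits.Ventures.PercRepro2.L1SDefs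
import Summits.Ventures.PercRepro2.L1SDel
import Summits.Ventures.PercRepro2.L1S
import Summits.Ventures.PercRepro2.OneEdge

/-!
# (CC-T⁻) in the S-frame, part 1: the pivotal event (blind cell PercRepro2, typer-1; mine-c g3
MINE-C.md §10.6 (c))

`R⁻ = {S ∩ T = ∅}` is the `e`-closed avoidance (`Rminus`), `hitDel T W w = {C_{G−W}(w) hits T}`.
**`notMem_Rplus_iff_of_SEvent`**: on `{S = W} ∩ R⁻` with `e = {u, w}`, the `e`-open avoidance `R⁺`
fails exactly when one end of `e` lies in `W` and the other end's cluster in `G − W` hits `T` — the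
event "`e` is pivotal for `s ↔ T`", from `OneEdge.conn_update_true_iff` and the cell's
`cluster_delConfig_cluster`. Used by `CCTMinusFrame.lean`.
-/

namespace Summit.Ventures.PercRepro2

namespace SFrame

open PASub CCTLin TwoSetRung OneEdge

open scoped Classical

variable {V : Type*} {E : Type*} [Fintype E] [DecidableEq E] [Fintype V] [DecidableEq V]
  {R : Type*} [Field R] [LinearOrder R] [IsStrictOrderedRing R]

/-! ## The `e`-closed avoidance and the pivotal events -/

section Objects

variable (ends : E → Sym2 V) (e : E) (s : V) (T : Finset V)

/-- `R⁻ = {s avoids T in ω⁻}`. -/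
def Rminus : Set (Config E) := {ω | Function.update ω e false ∈ avoidAll ends s T}

/-- `{C_{G−W}(w) hits T}`: the far end `w` reaches `T` in `G − W`. -/
def hitDel (W : Set V) (w : V) : Set (Config E) :=
  {ω | ∃ t ∈ T, t ∈ cluster ends (delConfig ends W ω) w}

omit [Fintype E] [Fintype V] [DecidableEq V] in
/-- On `{S = W}`, `R⁻` is `{W ∩ T = ∅}`. -/
lemma mem_Rminus_iff_of_SEvent {ω : Config E} {W : Set V}
    (hS : cluster ends (Function.update ω e false) s = W) :
    ω ∈ Rminus ends e s T ↔ ∀ t ∈ T, t ∉ W := by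
  simp only [Rminus, Set.mem_setOf_eq, avoidAll, ← mem_cluster, hS]

omit [Fintype E] [DecidableEq E] [Fintype V] [DecidableEq V] in
/-- `hitDel` depends only on the edges off `W`. -/
lemma dependsOn_hitDel (W : Set V) (w : V) :
    DependsOn (· ∈ hitDel ends T W w) (touches ends W)ᶜ := by
  intro ω ω' h
  show (∃ t ∈ T, t ∈ cluster ends (delConfig ends W ω) w) =
    (∃ t ∈ T, t ∈ cluster ends (delConfig ends W ω') w)
  rw [delConfig_congr h]

omit [Fintype E] [DecidableEq E] [Fintype V] [DecidableEq V] in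
/-- A vertex of `W` is isolated in `G − W`. -/
lemma cluster_delConfig_eq_singleton_of_mem {W : Set V} {w : V} (hw : w ∈ W) (ω : Config E) :
    cluster ends (delConfig ends W ω) w = {w} := by
  refine Set.Subset.antisymm ?_ (Set.singleton_subset_iff.2 (mem_cluster_self _ _ _))
  intro x hx
  refine mem_of_conn_of_closed (ends := ends) (ω := delConfig ends W ω) (S := {w}) ?_ rfl hx
  intro y hy z hyz
  obtain ⟨_, e', he', hends'⟩ := openGraph_adj.1 hyz
  rw [Set.mem_singleton_iff] at hy
  subst hy
  have ht : e' ∈ touches ends W := ⟨y, hw, z, hends'⟩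
  rw [delConfig_apply_of_mem ht] at he'
  exact absurd he' Bool.false_ne_true

omit [Fintype E] [DecidableEq E] [Fintype V] [DecidableEq V] in
/-- If `w ∈ W` and `W ∩ T = ∅`, the far end cannot hit `T`. -/
lemma hitDel_eq_empty_of_mem {W : Set V} {w : V} (hw : w ∈ W) (hT : ∀ t ∈ T, t ∉ W) :
    hitDel ends T W w = ∅ := by
  ext ω
  simp only [hitDel, Set.mem_setOf_eq, Set.mem_empty_iff_false, iff_false, not_exists, not_and]
  intro t ht hc
  rw [cluster_delConfig_eq_singleton_of_mem ends hw, Set.mem_singleton_iff] at hc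
  subst hc
  exact hT t ht hw

omit [Fintype E] [Fintype V] [DecidableEq V] in
/-- Closing `e` does not change `G − W` when `e` touches `W`. -/
lemma delConfig_update_false_of_touches {W : Set V} {e : E} (he : e ∈ touches ends W)
    (ω : Config E) : delConfig ends W (Function.update ω e false) = delConfig ends W ω := by
  funext e'
  by_cases h : e' ∈ touches ends W
  · rw [delConfig_apply_of_mem h, delConfig_apply_of_mem h]
  · rw [delConfig_apply_of_notMem h, delConfig_apply_of_notMem h,
      Function.update_of_ne (fun h' => h (by rw [h']; exact he))]

omit [Fintype E] [Fintype V] [DecidableEq V] in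
/-- On `{S = W}`, the far end `z ∉ W` of an edge `{x, z}` with `x ∈ W` is joined in `ω⁻` exactly to
its cluster in `G − W`. -/
lemma conn_update_false_iff_mem_delConfig {ω : Config E} {W : Set V}
    (hS : cluster ends (Function.update ω e false) s = W) {x z : V} (hxz : ends e = s(x, z))
    (hx : x ∈ W) (hz : z ∉ W) (t : V) :
    Conn ends (Function.update ω e false) z t ↔ t ∈ cluster ends (delConfig ends W ω) z := by
  have he : e ∈ touches ends W := mem_touches_of_ends hxz (Or.inl hx)
  have hz' : z ∉ cluster ends (Function.update ω e false) s := by rw [hS]; exact hz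
  have key := cluster_delConfig_cluster (ends := ends) (ω := Function.update ω e false) (s := s)
    (t := z) hz'
  rw [hS, delConfig_update_false_of_touches ends he ω] at key
  rw [key]
  rfl

omit [Fintype E] [Fintype V] [DecidableEq V] in
/-- **The pivotal event**: on `{S = W} ∩ R⁻` with `e = {u, w}`, `R⁺` fails iff one end of `e` lies in
`W` and the other end's cluster in `G − W` hits `T`. -/
lemma notMem_Rplus_iff_of_SEvent {u w : V} (hends : ends e = s(u, w)) {ω : Config E} {W : Set V}
    (hS : cluster ends (Function.update ω e false) s = W) (hT : ∀ t ∈ T, t ∉ W) :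
    ω ∉ Rplus ends e s T ↔
      (u ∈ W ∧ ω ∈ hitDel ends T W w) ∨ (w ∈ W ∧ ω ∈ hitDel ends T W u) := by
  have hplus : Function.update ω e true =
      Function.update (Function.update ω e false) e true := by
    rw [Function.update_idem]
  have hmemW : ∀ v, Conn ends (Function.update ω e false) s v ↔ v ∈ W := fun v => by
    rw [← hS]; rfl
  have hends' : ends e = s(w, u) := by rw [hends, Sym2.eq_swap]
  simp only [Rplus, Set.mem_setOf_eq, avoidAll, not_forall, not_not, hplus,
    conn_update_true_iff hends (Function.update ω e false) s, hmemW, hitDel]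
  constructor
  · rintro ⟨t, ht, hc⟩
    rcases hc with htW | ⟨hu, hwt⟩ | ⟨hw, hut⟩
    · exact absurd htW (hT t ht)
    · by_cases hw : w ∈ W
      · exact absurd ((hmemW t).1 (conn_trans ((hmemW w).2 hw) hwt)) (hT t ht)
      · exact Or.inl ⟨hu, t, ht,
          (conn_update_false_iff_mem_delConfig ends e s hS hends hu hw t).1 hwt⟩
    · by_cases hu : u ∈ W
      · exact absurd ((hmemW t).1 (conn_trans ((hmemW u).2 hu) hut)) (hT t ht)
      · exact Or.inr ⟨hw, t, ht,
          (conn_update_false_iff_mem_delConfig ends e s hS hends' hw hu t).1 hut⟩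
  · rintro (⟨hu, t, ht, hc⟩ | ⟨hw, t, ht, hc⟩)
    · by_cases hw : w ∈ W
      · rw [cluster_delConfig_eq_singleton_of_mem ends hw, Set.mem_singleton_iff] at hc
        subst hc
        exact absurd hw (hT t ht)
      · exact ⟨t, ht, Or.inr (Or.inl ⟨hu,
          (conn_update_false_iff_mem_delConfig ends e s hS hends hu hw t).2 hc⟩)⟩
    · by_cases hu : u ∈ W
      · rw [cluster_delConfig_eq_singleton_of_mem ends hu, Set.mem_singleton_iff] at hc
        subst hc
        exact absurd hu (hT t ht)
      · exact ⟨t, ht, Or.inr (Or.inr ⟨hw,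
          (conn_update_false_iff_mem_delConfig ends e s hS hends' hw hu t).2 hc⟩)⟩

omit [Fintype E] [Fintype V] [DecidableEq V] in
/-- On `{S = W}`, the `e`-closed connection `X⁻ = {s ↔ a in ω⁻}` is `{a ∈ W}`. -/
lemma mem_Xminus_iff_of_SEvent {ω : Config E} {W : Set V}
    (hS : cluster ends (Function.update ω e false) s = W) (a : V) :
    ω ∈ Xminus ends e s a ↔ a ∈ W := by
  show Conn ends (Function.update ω e false) s a ↔ a ∈ W
  rw [← hS]; rfl

end Objects

end SFrame

end Summit.Ventures.PercRepro2
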